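import Literature.MathematicalPhysics.KineticTheory.Sweep1
import Literature.Analysis.FluidPDE.BoltzmannGradLimitProofs
import Literature.MathematicalPhysics.KineticTheory.TaggedSphereLinearBoltzmann
import Literature.MathematicalPhysics.KineticTheory.LanfordClassBounds
import HarnessLib

/-!
# Hilbert's sixth problem, sweep 1: Lanford's theorem in mode B for the canonical ensemble — the glue

Companion of `Literature.MathematicalPhysics.KineticTheory.Sweep1` for the named fact
`lanford_tendstoEmpirical` (**hilbert6.S08**: along an exact Boltzmann–Grad sequence
`N_k ε_k^{d-1} = 1` of hard-sphere systems on `T^d` with canonical Gibbs-type data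
`𝒵_N⁻¹ 1_{D_ε^N} f₀^{⊗N}`, the empirical measure at time `t ∈ [0, T]` converges in probability to
`f(t) dx dv`, `f` the Boltzmann solution; Lanford 1975, Gallagher–Saint-Raymond–Texier 2013 Thm 8
and §2.4, Cercignani–Illner–Pulvirenti 1994 Thm 4.4.1 and §4.6, Sznitman 1991 Prop. 2.2).

The fact is Lanford's theorem read in "mode B". Its proof consists of Lanford's theorem proper
(convergence of the BBGKY marginals, "mode A", GST 2013 Thm 8 for the conditioned data of
§6.1) and a layer of measure theory turning mode A into mode B. This file proves the whole second
layer and states the first as the hypothesis of the final reduction; nothing here is specific to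
the (absent) proof of Lanford's theorem, and no new named fact is introduced.

## Contents

1. `LanfordEmpirical.tendsto_integral_tensorPow_mul_nthMarginal_ae`,
   `LanfordEmpirical.tendstoEmpirical_of_ae_versions` — *mode A for versions ⇒ mode B*, over a
   general position space: the variant of the prelude's discharged fact
   `Literature.Analysis.FluidPDE.TendstoMarginals.tendstoEmpirical`
   (`…BoltzmannGradLimitProofs`) in which mode-A convergence is assumed only for *versions*
   (a.e.-representatives, for each `k, s, t`) of the marginals of the time-`t` densities
   `1_{good} · W_k ∘ Φ^k_{-t}` — exactly what the BBGKY hierarchy provides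
   (`Literature.Analysis.FluidPDE.liouville_imp_bbgky` asserts versions of these marginals solving
   the hierarchy) — at the price of assuming the limit `f(t)` measurable. The proof is that of the
   quoted theorem (Sznitman 1991 Prop. 2.2 (i)⇒(ii) via Chaintron–Diez 2022 Lemma 3.19, velocity
   cut-offs and a Fatou/Pratt argument), reorganised around the observation that versions have
   the same velocity averages at almost every position configuration
   (`LanfordEmpirical.ae_velocityAverage_congr`), which is all the dominated-convergence step uses.
2. `LanfordEmpirical.canonicalPartition_succ_ge`, `…canonicalPartition_pos_of_lt`,
   `…canonicalPartition_eventually_pos` — GST 2013 Prop. 6.1.1 on `T^d` for a general probability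
   density `f₀ ≤ C M_β` (the Maxwellian case is in `…TaggedSphereLinearBoltzmann`, after
   Bodineau–Gallagher–Saint-Raymond 2016 Appendix A): `𝒵_{n+1} ≥ (1 - n (2ε)^d C) 𝒵_n`, hence
   `𝒵_{N_k} > 0` eventually along `N_k ε_k^{d-1} = 1`; for finitely many `k` the canonical datum
   `Literature.Analysis.FluidPDE.canonicalDensity` may be the junk `0` (then its law is `0`).
3. `lanford_tendstoEmpirical_of_canonicalChaos` — the reduction: Lanford's theorem in mode A for
   the canonical ensemble on `T^d` (hypothesis `H`, in the vocabulary of `Sweep1`/the prelude, with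
   versions and good-set restriction as in `liouville_imp_bbgky`) implies `lanford_tendstoEmpirical`.
   Ingredients: 2., conservation of mass of the mild solution
   (`Literature.Analysis.FluidPDE.IsMildBoltzmannSolutionOn.totalMass_eq_holds`, with the uniform
   Gaussian bound of `exists_abs_le_of_continuousInLanfordOn`), `N_k → ∞`
   (`IsBoltzmannGradSequence.tendsto_atTop`), and 1. applied to the sequence shifted past its
   degenerate initial terms (limits in `k` are shift invariant).

## What is NOT here

Lanford's theorem itself (hypothesis `H` of `lanford_tendstoEmpirical_of_canonicalChaos`; GST
2013 Part II Chs. 5–7 and Part IV for hard spheres, on top of the BBGKY hierarchy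
`liouville_imp_bbgky`, itself an undischarged fact). With it, `lanford_tendstoEmpirical_holds`
is the one-liner `lanford_tendstoEmpirical_of_canonicalChaos H`.

## References

* O. E. Lanford, *Time evolution of large classical systems*, LNP 38 (1975) 1–111.
* I. Gallagher, L. Saint-Raymond, B. Texier, *From Newton to Boltzmann: hard spheres and
  short-range potentials*, EMS (2013) = arXiv:1208.5753, §2.3–2.4, §6.1 (6.1.2)–(6.1.3),
  Prop. 6.1.1–6.1.2, Thm 8.
* C. Cercignani, R. Illner, M. Pulvirenti, *The Mathematical Theory of Dilute Gases* (1994),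
  Thm 4.4.1, §4.6 (Lemmas 4.6.2–4.6.3).
* A.-S. Sznitman, *Topics in propagation of chaos*, LNM 1464 (1991), Prop. 2.2.
* L.-P. Chaintron, A. Diez, *Propagation of chaos: a review …* I, KRM 15 (2022), Lemma 3.19.
* T. Bodineau, I. Gallagher, L. Saint-Raymond, Invent. Math. 203 (2016), Appendix A.
-/

open MeasureTheory Set Filter Topology Function
open scoped ENNReal
open Literature.Analysis.FluidPDE Literature.Analysis.FunctionSpaces

namespace Literature.MathematicalPhysics.KineticTheory

noncomputable section

namespace LanfordEmpirical

variable {d : Type*} {X : Type*}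

/-! ## Versions: a.e.-equal marginals have a.e.-equal velocity averages -/

section AeVersions

variable [Fintype d] [MeasureSpace X] [SigmaFinite (volume : Measure X)]

/-- Two a.e.-equal functions of `s`-particle configurations have, for almost every position
configuration `x_s`, the same velocity averages against any (position dependent) observable
(Fubini on `Config s ≃ (Fin s → X) × (Fin s → ℝ^d)`). [folklore] -/
theorem ae_velocityAverage_congr {s : ℕ} {F G : Config s d X → ℝ} (hFG : F =ᵐ[volume] G)
    (Ψ : Config s d X → ℝ) :
    ∀ᵐ xs : Fin s → X, velocityAverage (fun vs => Ψ fun i => (xs i, vs i)) F xs =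
      velocityAverage (fun vs => Ψ fun i => (xs i, vs i)) G xs := by
  obtain ⟨e, he, hmp⟩ := exists_zipEquiv (d := d) (X := X) s
  have h1 : (F ∘ e) =ᵐ[volume] (G ∘ e) := hmp.quasiMeasurePreserving.ae_eq_comp hFG
  rw [Measure.volume_eq_prod] at h1
  have h2 := Measure.ae_ae_of_ae_prod h1
  filter_upwards [h2] with xs hxs
  simp only [velocityAverage]
  refine integral_congr_ae ?_
  filter_upwards [hxs] with vs hvs
  simp only [Function.comp_apply, he] at hvs
  rw [hvs]

end AeVersions

/-! ## From mode A for versions of the marginals to the convergence of `∫ φ^{⊗s} F_k^{(s)}` -/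

section Core

variable [Fintype d] [MeasureSpace X] [TopologicalSpace X] [OpensMeasurableSpace X]
  [SigmaFinite (volume : Measure X)]

/-- **From mode A (for versions) to the convergence of `∫ φ^{⊗s} F_k^{(s)}`.** The variant of
`Literature.Analysis.FluidPDE.TendstoMarginals.tendsto_integral_tensorPow_mul_nthMarginal` in
which mode-A convergence is only known for *versions* `F_k^{(s)}(t) = (ρ_k(t))^{(s)}` a.e. of the
marginals of the probability densities `ρ_k(t)` (as delivered by the BBGKY hierarchy,
`Literature.Analysis.FluidPDE.liouville_imp_bbgky`, whose solutions are versions of the marginals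
of the transported density), the limit `f(t)` being a *measurable* probability density. The
conclusion is about the honest marginals: `∫ φ^{⊗s} (ρ_k(t))^{(s)} → (∫∫ φ f(t))^s` for every `s`
for which "off-diagonal everywhere implies almost everywhere" (`hnull`; `s ≤ 2` when points are
null). Proof: as for the quoted theorem (Fubini, mode A pointwise, velocity cut-offs, a
Fatou/Pratt argument with mass defect), except that mode A now holds at almost every (instead
of every) off-diagonal position configuration — versions have the same velocity averages at
almost every `x_s` (`ae_velocityAverage_congr`) — which is all the dominated-convergence
argument uses; measurability of `x ↦ ∫ ψ(x, v) f(t, x, v) dv`, obtained there as an everywhere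
limit, is here read off the measurability of `f(t)`. [folklore] -/
theorem tendsto_integral_tensorPow_mul_nthMarginal_ae
    {Nk : ℕ → ℕ} (hN : Tendsto Nk atTop atTop) {T : ℝ}
    {ρ : (k : ℕ) → ℝ → Config (Nk k) d X → ℝ}
    (hρm : ∀ k t, Measurable (ρ k t)) (hρ0 : ∀ k t, 0 ≤ ρ k t)
    (hρ1 : ∀ k, ∀ t ∈ Icc 0 T, ∫ z, ρ k t z = 1)
    {f : ℝ → X × EuclideanSpace ℝ d → ℝ} (hf0 : ∀ t ∈ Icc 0 T, 0 ≤ f t)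
    (hf1 : ∀ t ∈ Icc 0 T, ∫ x : X, ∫ v : EuclideanSpace ℝ d, f t (x, v) = 1)
    (hfm : ∀ t ∈ Icc 0 T, Measurable (f t))
    {Fk : ℕ → (s : ℕ) → ℝ → Config s d X → ℝ}
    (hF : ∀ k s, ∀ t ∈ Icc 0 T, Fk k s t =ᵐ[volume] nthMarginal (Nk k) s (ρ k t))
    (h : TendstoMarginals Fk (fun s t => tensorPow s (f t)) T)
    {t : ℝ} (ht : t ∈ Icc 0 T) {φ : X × EuclideanSpace ℝ d → ℝ} (hφc : Continuous φ)
    (hφs : HasCompactSupport φ) (s : ℕ)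
    (hnull : ∀ P : (Fin s → X) → Prop, MeasurableSet {xs | P xs} →
      (∀ xs ∈ offDiag (X := X) s, P xs) → ∀ᵐ xs : Fin s → X, P xs) :
    Tendsto (fun k => ∫ zs, tensorPow s φ zs * nthMarginal (Nk k) s (ρ k t) zs) atTop
      (𝓝 ((∫ x : X, ∫ v : EuclideanSpace ℝ d, φ (x, v) * f t (x, v)) ^ s)) := by
  classical
  obtain ⟨cutoff, cutoff_nonneg, abs_cutoff_le, continuous_cutoff, cutoff_eq_one, cutoff_eq_zero,
    tendsto_cutoff⟩ := exists_cutoff (EuclideanSpace ℝ d)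
  /- Notation. `V = ℝ^d`; `Fs k s' = (ρ_k(t))^{(s')}` (honest marginals); for a one-particle
  function `ψ`, `θ ψ x = ∫ ψ(x, v) f(t, x, v) dv` and `VA s' ψ F x_s = I_{ψ^{⊗s'}(x_s, ·)} F (x_s)`. -/
  set Fs : ℕ → (s' : ℕ) → Config s' d X → ℝ := fun k s' => nthMarginal (Nk k) s' (ρ k t)
    with hFs
  set θ : (X × EuclideanSpace ℝ d → ℝ) → X → ℝ := fun ψ x => ∫ v, ψ (x, v) * f t (x, v) with hθ
  set VA : (s' : ℕ) → (X × EuclideanSpace ℝ d → ℝ) → (Config s' d X → ℝ) → (Fin s' → X) → ℝ :=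
    fun s' ψ F xs => velocityAverage (fun vs => tensorPow s' ψ (fun i => (xs i, vs i))) F xs
    with hVA
  have hft0 : 0 ≤ f t := hf0 t ht
  have hftm : Measurable (f t) := hfm t ht
  -- basic properties of the marginals
  have hFsm : ∀ k s', Measurable (Fs k s') := fun k s' => measurable_nthMarginal _ _ (hρm k t)
  have hFs0 : ∀ k s', 0 ≤ Fs k s' := fun k s' zs => nthMarginal_nonneg _ _ (hρ0 k t) zs
  /- Step 0: total mass `1`, integrability of `ρ_k(t)` and of its marginals. -/
  have hm1 : ∀ k, ∫ z, ρ k t z = 1 := fun k => hρ1 k t ht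
  have hint : ∀ k, Integrable (ρ k t) := fun k => by
    by_contra hnot
    have := hm1 k
    rw [integral_undef hnot] at this
    exact zero_ne_one this
  have hFsi : ∀ s', ∀ᶠ k in atTop, s' ≤ Nk k ∧ Integrable (ρ k t) ∧ Integrable (Fs k s') := by
    intro s'
    filter_upwards [hN.eventually_ge_atTop s'] with k hk
    exact ⟨hk, hint k, integrable_nthMarginal hk (hint k)⟩
  /- Versions: for every observable, a.e. in the positions the velocity averages of the
  versions `Fk k s' t` and of the honest marginals `Fs k s'` agree, for all `k` at once. -/
  have hver : ∀ (s' : ℕ) (Ψ : Config s' d X → ℝ), ∀ᵐ xs : Fin s' → X, ∀ k,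
      velocityAverage (fun vs => Ψ fun i => (xs i, vs i)) (Fk k s' t) xs =
        velocityAverage (fun vs => Ψ fun i => (xs i, vs i)) (Fs k s') xs := by
    intro s' Ψ
    rw [ae_all_iff]
    intro k
    exact ae_velocityAverage_congr (hF k s' t ht) Ψ
  /- General facts about "admissible" one-particle observables `ψ` (measurable, bounded,
  continuous in `v`, vanishing for `v` off a compact set). -/
  -- (A1) mode A at almost every off-diagonal point, limit computed by Fubini
  have hA1 : ∀ (ψ : X × EuclideanSpace ℝ d → ℝ) (KV : Set (EuclideanSpace ℝ d)), IsCompact KV →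
      (∀ x, Continuous fun v => ψ (x, v)) → (∀ x, ∀ v ∉ KV, ψ (x, v) = 0) →
      ∀ (s' : ℕ), ∀ᵐ xs : Fin s' → X, xs ∈ offDiag s' →
        Tendsto (fun k => VA s' ψ (Fs k s') xs) atTop (𝓝 (∏ i, θ ψ (xs i))) := by
    intro ψ KV hKV hψc hψ0 s'
    filter_upwards [hver s' (tensorPow s' ψ)] with xs hxs hoff
    obtain ⟨hc, hs⟩ := continuous_hasCompactSupport_tensorPow_zip hψc hKV hψ0 s' xs
    have := h.tendsto_velocityAverage_apply ht s' hc hs hoff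
    rw [velocityAverage_tensorPow_tensorPow] at this
    exact this.congr fun k => hxs k
  -- (A2) measurability of the velocity averages, for every `k`
  have hA2 : ∀ (ψ : X × EuclideanSpace ℝ d → ℝ), Measurable ψ → ∀ s' k,
      Measurable (VA s' ψ (Fs k s')) := fun ψ hψ s' k =>
    measurable_velocityAverage' (hFsm k s') (measurable_tensorPow hψ s')
  -- (A3) measurability of `θ ψ`, from the measurability of `f(t)`
  have hA3 : ∀ (ψ : X × EuclideanSpace ℝ d → ℝ), Measurable ψ → Measurable (θ ψ) := by
    intro ψ hψm
    have h1 : Measurable fun p : X × EuclideanSpace ℝ d => ψ p * f t p := hψm.mul hftm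
    exact (h1.stronglyMeasurable.integral_prod_right').measurable
  -- (Ae) almost everywhere convergence on `Fin s → X` (via `hnull`)
  have hAe : ∀ (ψ : X × EuclideanSpace ℝ d → ℝ) (KV : Set (EuclideanSpace ℝ d)), IsCompact KV →
      (∀ x, Continuous fun v => ψ (x, v)) → (∀ x, ∀ v ∉ KV, ψ (x, v) = 0) → Measurable ψ →
      ∀ᵐ xs : Fin s → X, Tendsto (fun k => VA s ψ (Fs k s) xs) atTop (𝓝 (∏ i, θ ψ (xs i))) := by
    intro ψ KV hKV hψc hψ0 hψm
    have hlm : Measurable fun xs : Fin s → X => ∏ i, θ ψ (xs i) :=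
      Finset.measurable_prod _ fun i _ => (hA3 ψ hψm).comp (measurable_pi_apply i)
    set S : Set (Fin s → X) :=
      {xs | Tendsto (fun k => VA s ψ (Fs k s) xs) atTop (𝓝 (∏ i, θ ψ (xs i)))} with hSdef
    have hSm : MeasurableSet S := by
      have hset : S = {xs | Tendsto (fun k => VA s ψ (Fs k s) xs - ∏ i, θ ψ (xs i)) atTop (𝓝 0)} := by
        ext xs
        exact tendsto_sub_nhds_zero_iff.symm
      rw [hset]
      exact measurableSet_tendsto (𝓝 (0 : ℝ)) fun k => (hA2 ψ hψm s k).sub hlm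
    -- the exceptional set of (A1), enlarged to a measurable null set
    set Z : Set (Fin s → X) := {xs | ¬ (xs ∈ offDiag s →
      Tendsto (fun k => VA s ψ (Fs k s) xs) atTop (𝓝 (∏ i, θ ψ (xs i))))} with hZdef
    have hZ0 : volume Z = 0 := by
      have := hA1 ψ KV hKV hψc hψ0 s
      rw [ae_iff] at this
      exact this
    set Z' : Set (Fin s → X) := toMeasurable volume Z with hZ'def
    have hZ'm : MeasurableSet Z' := measurableSet_toMeasurable _ _
    have hZ'0 : volume Z' = 0 := by rw [hZ'def, measure_toMeasurable]; exact hZ0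
    have hP : ∀ᵐ xs : Fin s → X, xs ∈ S ∪ Z' := by
      refine hnull (fun xs => xs ∈ S ∪ Z') (hSm.union hZ'm) fun xs hxs => ?_
      by_cases hz : xs ∈ Z'
      · exact Or.inr hz
      · have hz' : xs ∉ Z := fun h' => hz (subset_toMeasurable _ _ h')
        left
        simp only [hZdef, Set.mem_setOf_eq, not_not] at hz'
        exact hz' hxs
    have hZ'ae : ∀ᵐ xs : Fin s → X, xs ∉ Z' := by
      rw [ae_iff]
      simpa using hZ'0
    filter_upwards [hP, hZ'ae] with xs hxs hxs'
    rcases hxs with h1 | h1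
    · exact h1
    · exact absurd h1 hxs'
  -- transfer between `X` and `Fin 1 → X`
  set e₁ := MeasurableEquiv.funUnique (Fin 1) X with he₁def
  have he₁ : MeasurePreserving e₁ volume volume := volume_preserving_funUnique (Fin 1) X
  have he₁c : ∀ xs : Fin 1 → X, (fun _ : Fin 1 => e₁ xs) = xs := fun xs => by
    funext i
    rw [Subsingleton.elim i 0]
    rfl
  -- (A4) integrability of `θ ψ` for `ψ ≥ 0` (Fatou at `s = 1`), with `∫ θ ψ ≤ B`
  have hA4 : ∀ (ψ : X × EuclideanSpace ℝ d → ℝ) (KV : Set (EuclideanSpace ℝ d)), IsCompact KV →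
      (∀ x, Continuous fun v => ψ (x, v)) → (∀ x, ∀ v ∉ KV, ψ (x, v) = 0) → Measurable ψ →
      0 ≤ ψ → ∀ B, 0 ≤ B → (∀ p, |ψ p| ≤ B) → Integrable (θ ψ) := by
    intro ψ KV hKV hψc hψ0 hψm hψ0' B hB0 hB
    set u : ℕ → X → ℝ := fun k x => VA 1 ψ (Fs k 1) (fun _ => x) with hu
    have hum : ∀ k, Measurable (u k) := fun k =>
      (hA2 ψ hψm 1 k).comp (measurable_pi_lambda _ fun _ => measurable_id)
    have hu0 : ∀ k x, 0 ≤ u k x := fun k x =>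
      velocityAverage_nonneg (hFs0 k 1) (fun vs => tensorPow_nonneg hψ0' 1 _) _
    -- a.e. convergence at `s = 1` (every `x_1` is off-diagonal), transported to `X`
    have hlim1 : ∀ᵐ xs : Fin 1 → X, Tendsto (fun k => VA 1 ψ (Fs k 1) xs) atTop
        (𝓝 (θ ψ (xs 0))) := by
      filter_upwards [hA1 ψ KV hKV hψc hψ0 1] with xs hxs
      have := hxs (fun i j hij => absurd (Subsingleton.elim i j) hij)
      simpa using this
    have hlim : ∀ᵐ x : X, Tendsto (fun k => u k x) atTop (𝓝 (θ ψ x)) := by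
      have h1 := he₁.symm e₁ |>.quasiMeasurePreserving.ae hlim1
      filter_upwards [h1] with x hx
      have hsymm : (e₁.symm x : Fin 1 → X) = fun _ => x := by
        funext i
        rw [← he₁c (e₁.symm x)]
        simp
      simpa only [hu, hsymm] using hx
    refine (integrable_of_tendsto_of_integral_le (μ := volume) (fun k => (hum k).aestronglyMeasurable)
      (fun k => Eventually.of_forall (hu0 k)) hlim (C := B) ?_).1
    filter_upwards [hFsi 1] with k hk
    obtain ⟨hk1, hρi, hF1i⟩ := hk
    have hΨm : Measurable (tensorPow 1 ψ : Config 1 d X → ℝ) := measurable_tensorPow hψm 1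
    have hΨb : ∀ z : Config 1 d X, |tensorPow 1 ψ z| ≤ B ^ 1 := abs_tensorPow_le hB 1
    have hVi : Integrable (VA 1 ψ (Fs k 1)) := integrable_velocityAverage' hF1i hΨm hΨb
    -- `u k ∘ e₁ = VA 1 ψ (Fs k 1)`
    have hue : (u k ∘ e₁) = VA 1 ψ (Fs k 1) := by
      funext xs
      simp only [Function.comp_apply, hu, he₁c xs]
    have hui : Integrable (u k) := by
      rw [← he₁.integrable_comp_emb e₁.measurableEmbedding, hue]
      exact hVi
    refine ⟨hui, ?_⟩
    calc ∫ x, u k x = ∫ xs, VA 1 ψ (Fs k 1) xs := by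
          rw [← he₁.integral_comp']
          exact integral_congr_ae (Eventually.of_forall fun xs => congrFun hue xs)
      _ = ∫ zs, tensorPow 1 ψ zs * Fs k 1 zs :=
          (integral_mul_eq_integral_velocityAverage hF1i hΨm hΨb).symm
      _ = ∫ z, tensorPow 1 ψ (fun i => z (Fin.castLE hk1 i)) * ρ k t z :=
          (integral_mul_nthMarginal hk1 hρi hΨm hΨb).symm
      _ ≤ ∫ z, B * ρ k t z := by
          refine integral_mono_of_nonneg (Eventually.of_forall fun z =>
            mul_nonneg (tensorPow_nonneg hψ0' 1 _) (hρ0 k t z)) (hρi.const_mul B)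
            (Eventually.of_forall fun z => ?_)
          have := hΨb (fun i => z (Fin.castLE hk1 i))
          rw [pow_one] at this
          exact mul_le_mul_of_nonneg_right ((le_abs_self _).trans this) (hρ0 k t z)
      _ = B * ∫ z, ρ k t z := integral_const_mul _ _
      _ = B := by rw [hm1 k, mul_one]
  /- Properties of `φ` and of the cut-offs `χ_n(x, v) = cutoff n v`. -/
  obtain ⟨M, hM0, hM⟩ : ∃ M, 0 ≤ M ∧ ∀ p, |φ p| ≤ M := by
    obtain ⟨M, hM⟩ := hφs.exists_bound_of_continuous hφc
    exact ⟨max M 0, le_max_right _ _, fun p => (by simpa using hM p : |φ p| ≤ M).trans (le_max_left _ _)⟩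
  have hφm : Measurable φ := hφc.measurable
  set KV : Set (EuclideanSpace ℝ d) := Prod.snd '' tsupport φ with hKVdef
  have hKV : IsCompact KV := hφs.image continuous_snd
  have hφcv : ∀ x, Continuous fun v : EuclideanSpace ℝ d => φ (x, v) := fun x => by fun_prop
  have hφ0 : ∀ x, ∀ v ∉ KV, φ (x, v) = 0 := fun x v hv => by
    by_contra hne
    exact hv ⟨(x, v), subset_tsupport _ hne, rfl⟩
  obtain ⟨R₀, hR₀⟩ : ∃ R₀ : ℕ, KV ⊆ Metric.closedBall (0 : EuclideanSpace ℝ d) R₀ := by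
    obtain ⟨r, hr⟩ := hKV.isBounded.subset_closedBall (0 : EuclideanSpace ℝ d)
    exact ⟨⌈r⌉₊, hr.trans (Metric.closedBall_subset_closedBall (Nat.le_ceil r))⟩
  set χ : ℕ → X × EuclideanSpace ℝ d → ℝ := fun n p => cutoff n p.2 with hχ
  have hχm : ∀ n, Measurable (χ n) := fun n =>
    (continuous_cutoff n).measurable.comp measurable_snd
  have hχ0 : ∀ n, 0 ≤ χ n := fun n p => cutoff_nonneg n p.2
  have hχ1 : ∀ n p, |χ n p| ≤ 1 := fun n p => abs_cutoff_le n p.2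
  have hχc : ∀ n x, Continuous fun v : EuclideanSpace ℝ d => χ n (x, v) := fun n x =>
    continuous_cutoff n
  have hχK : ∀ n : ℕ, IsCompact (Metric.closedBall (0 : EuclideanSpace ℝ d) ((n : ℝ) + 1)) :=
    fun n => isCompact_closedBall _ _
  have hχ0' : ∀ (n : ℕ) x, ∀ v ∉ Metric.closedBall (0 : EuclideanSpace ℝ d) ((n : ℝ) + 1),
      χ n (x, v) = 0 := by
    intro n x v hv
    rw [Metric.mem_closedBall, dist_zero_right, not_le] at hv
    exact cutoff_eq_zero hv.le
  have hφχ : ∀ n : ℕ, R₀ ≤ n → ∀ p, |φ p| ≤ M * χ n p := by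
    intro n hn p
    by_cases hp : p.2 ∈ KV
    · have h1 : χ n p = 1 := by
        refine cutoff_eq_one ?_
        have := hR₀ hp
        rw [Metric.mem_closedBall, dist_zero_right] at this
        exact this.trans (by exact_mod_cast hn)
      rw [h1, mul_one]
      exact hM p
    · have : φ p = 0 := hφ0 p.1 p.2 hp
      rw [this, abs_zero]
      exact mul_nonneg hM0 (hχ0 n p)
  /- Tightness: `∫ θ (χ n) → 1⁻` as `n → ∞`, from `∫∫ f(t) = 1` (Fatou in `n`). -/
  set n₀ : X → ℝ := fun x => ∫ v, f t (x, v) with hn₀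
  have hn₀1 : ∫ x, n₀ x = 1 := hf1 t ht
  have hn₀i : Integrable n₀ := by
    by_contra hnot
    rw [integral_undef hnot] at hn₀1
    exact zero_ne_one hn₀1
  have hn₀0 : 0 ≤ n₀ := fun x => integral_nonneg fun v => hft0 _
  have hθχi : ∀ n, Integrable (θ (χ n)) := fun n =>
    hA4 (χ n) _ (hχK n) (hχc n) (hχ0' n) (hχm n) (hχ0 n) 1 zero_le_one (hχ1 n)
  have hθχ0 : ∀ n, 0 ≤ θ (χ n) := fun n x =>
    integral_nonneg fun v => mul_nonneg (hχ0 n _) (hft0 _)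
  have hθχlim : ∀ x, n₀ x = 0 ∨ Tendsto (fun n => θ (χ n) x) atTop (𝓝 (n₀ x)) := by
    intro x
    by_cases hx : Integrable (fun v => f t (x, v))
    · right
      have := tendsto_integral_of_dominated_convergence (fun v => f t (x, v))
        (F := fun n v => χ n (x, v) * f t (x, v)) (f := fun v => f t (x, v))
        (fun n => ((continuous_cutoff n).aestronglyMeasurable.mul hx.aestronglyMeasurable))
        hx (fun n => Eventually.of_forall fun v => by
          rw [Real.norm_eq_abs, abs_mul, abs_of_nonneg (hft0 _)]
          exact mul_le_of_le_one_left (hft0 _) (hχ1 n _))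
        (Eventually.of_forall fun v => by
          simpa using (tendsto_cutoff v).mul_const (f t (x, v)))
      simpa using this
    · left
      exact integral_undef hx
  have htight : ∀ ε : ℝ, 0 < ε → ∀ᶠ n in atTop, 1 - ε ≤ ∫ x, θ (χ n) x := by
    intro ε hε
    have := le_integral_add_of_tendsto (μ := volume) (u := fun n => θ (χ n)) (v := n₀)
      (fun n => (hθχi n).aestronglyMeasurable)
      (Eventually.of_forall fun n => ⟨hθχi n, Eventually.of_forall (hθχ0 n)⟩)
      hn₀i (Eventually.of_forall hn₀0) (Eventually.of_forall hθχlim) hε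
    simpa only [hn₀1] using this
  /- Main step: dominated convergence with mass defect on `Fin s → X`. -/
  have hmain : Tendsto (fun k => ∫ xs, VA s φ (Fs k s) xs) atTop
      (𝓝 (∫ xs : Fin s → X, ∏ i, θ φ (xs i))) := by
    refine tendsto_integral_of_dominated_defect (μ := volume)
      (fun k => (hA2 φ hφm s k).aestronglyMeasurable) (hAe φ KV hKV hφcv hφ0 hφm) ?_
    intro η hη
    -- choice of `ε` and of the cut-off `n`
    set A : ℝ := M ^ s * (s + 1) with hA
    have hA0 : 0 ≤ A := by positivity
    set ε : ℝ := min 1 (η / (A + 1)) with hεdef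
    have hε0 : 0 < ε := lt_min one_pos (div_pos hη (by linarith))
    have hε1 : ε ≤ 1 := min_le_left _ _
    have hεA : A * ε ≤ η := by
      calc A * ε ≤ A * (η / (A + 1)) := mul_le_mul_of_nonneg_left (min_le_right _ _) hA0
        _ = η * (A / (A + 1)) := by ring
        _ ≤ η * 1 := by
            refine mul_le_mul_of_nonneg_left ?_ hη.le
            rw [div_le_one (by linarith)]
            linarith
        _ = η := mul_one η
    obtain ⟨n, hnR, hn⟩ := ((eventually_ge_atTop R₀).and (htight ε hε0)).exists
    -- the dominating family
    set I : ℝ := ∫ x, θ (χ n) x with hI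
    have hI1 : 1 - ε ≤ I := hn
    have hGli0 : Integrable (fun xs : Fin s → X => ∏ i, θ (χ n) (xs i)) := by
      have := Integrable.fintype_prod (ι := Fin s) (f := fun _ => θ (χ n)) (μ := fun _ => volume)
        (fun _ => hθχi n)
      rw [← volume_pi] at this
      exact this
    refine ⟨fun k xs => M ^ s * VA s (χ n) (Fs k s) xs, fun xs => M ^ s * ∏ i, θ (χ n) (xs i),
      fun k => ((hA2 (χ n) (hχm n) s k).const_mul _).aestronglyMeasurable, hGli0.const_mul _,
      (hAe (χ n) _ (hχK n) (hχc n) (hχ0' n) (hχm n)).mono fun xs hxs => hxs.const_mul _, ?_⟩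
    filter_upwards [hFsi s] with k hk
    obtain ⟨hks, hρi, hFki⟩ := hk
    have hΦm : Measurable (tensorPow s φ : Config s d X → ℝ) := measurable_tensorPow hφm s
    have hΦb : ∀ z : Config s d X, |tensorPow s φ z| ≤ M ^ s := abs_tensorPow_le hM s
    have hXm : Measurable (tensorPow s (χ n) : Config s d X → ℝ) := measurable_tensorPow (hχm n) s
    have hXb : ∀ z : Config s d X, |tensorPow s (χ n) z| ≤ 1 ^ s :=
      abs_tensorPow_le (hχ1 n) s
    have hHi : Integrable (VA s φ (Fs k s)) := integrable_velocityAverage' hFki hΦm hΦb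
    have hGi : Integrable (VA s (χ n) (Fs k s)) := integrable_velocityAverage' hFki hXm hXb
    refine ⟨hGi.const_mul _, hHi, ?_, ?_⟩
    · exact ae_abs_velocityAverage_le hFki (hFs0 k s) hΦm hXm hΦb hXb
        (abs_tensorPow_le_mul_tensorPow (hφχ n hnR) s)
    · -- the mass defect
      have hmass : ∫ xs, VA s (χ n) (Fs k s) xs ≤ 1 := by
        calc ∫ xs, VA s (χ n) (Fs k s) xs = ∫ zs, tensorPow s (χ n) zs * Fs k s zs :=
              (integral_mul_eq_integral_velocityAverage hFki hXm hXb).symm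
          _ = ∫ z, tensorPow s (χ n) (fun i => z (Fin.castLE hks i)) * ρ k t z :=
              (integral_mul_nthMarginal hks hρi hXm hXb).symm
          _ ≤ ∫ z, ρ k t z := by
              refine integral_mono_of_nonneg (Eventually.of_forall fun z =>
                mul_nonneg (tensorPow_nonneg (hχ0 n) s _) (hρ0 k t z)) hρi
                (Eventually.of_forall fun z => ?_)
              have := hXb (fun i => z (Fin.castLE hks i))
              rw [one_pow] at this
              simpa using mul_le_mul_of_nonneg_right ((le_abs_self _).trans this) (hρ0 k t z)
          _ = 1 := hm1 k
      have hlim : ∫ xs : Fin s → X, M ^ s * ∏ i, θ (χ n) (xs i) = M ^ s * I ^ s := by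
        rw [integral_const_mul, integral_fintype_prod_volume_eq_prod (fun _ : Fin s => θ (χ n)),
          Finset.prod_const, Finset.card_univ, Fintype.card_fin]
      rw [integral_const_mul, hlim]
      -- `M^s · 1 ≤ M^s (1 - ε)^s + A ε ≤ M^s I^s + η`
      have hbern : 1 - (s : ℝ) * ε ≤ (1 - ε) ^ s := by
        have := one_add_mul_le_pow (a := -ε) (by linarith) s
        linarith [this, show (1 + -ε) ^ s = (1 - ε) ^ s by ring]
      have hIs : (1 - ε) ^ s ≤ I ^ s := pow_le_pow_left₀ (by linarith) hI1 s
      have hMs : 0 ≤ M ^ s := pow_nonneg hM0 s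
      calc M ^ s * ∫ xs, VA s (χ n) (Fs k s) xs ≤ M ^ s * (1 + ε) :=
            mul_le_mul_of_nonneg_left (hmass.trans (by linarith)) hMs
        _ = M ^ s * (1 - s * ε) + A * ε := by simp only [hA]; ring
        _ ≤ M ^ s * I ^ s + η := add_le_add (mul_le_mul_of_nonneg_left (hbern.trans hIs) hMs) hεA
  /- Identification of both sides. -/
  have hlimit : ∫ xs : Fin s → X, ∏ i, θ φ (xs i) =
      (∫ x : X, ∫ v : EuclideanSpace ℝ d, φ (x, v) * f t (x, v)) ^ s := by
    rw [integral_fintype_prod_volume_eq_prod (fun _ : Fin s => θ φ), Finset.prod_const,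
      Finset.card_univ, Fintype.card_fin]
  rw [← hlimit]
  refine hmain.congr' ?_
  filter_upwards [hFsi s] with k hk
  obtain ⟨-, -, hFki⟩ := hk
  exact (integral_mul_eq_integral_velocityAverage hFki (measurable_tensorPow hφm s)
    (abs_tensorPow_le hM s)).symm

end Core

/-! ## Assembly: mode A for versions of the good-set-restricted marginals ⇒ mode B -/

section Assembly

variable [Fintype d] [MeasureSpace X] [TopologicalSpace X]

/-- **Mode A (for versions) ⇒ mode B for hard spheres** (Sznitman 1991 Prop. 2.2 (i)⇒(ii), GST
2013 §2.4, in the form of Chaintron–Diez 2022 Lemma 3.19 as in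
`Literature.Analysis.FluidPDE.tendstoEmpirical_of_flow_comp_perm_ae`). Let `W_k` be symmetric
measurable probability densities of `N_k → ∞` hard spheres supported in `D_{ε_k}^{N_k}`, and
let `F_k^{(s)}(t)` be *versions* (a.e. in `Z_s`, for each `k, s, t`) of the marginals of the
time-`t` densities `1_{good} · W_k ∘ Φ^k_{-t}` (the density of the law at time `t`,
`Literature.Analysis.FluidPDE.map_flow_particleLaw`; this is the object of which the BBGKY
hierarchy produces versions, `Literature.Analysis.FluidPDE.liouville_imp_bbgky`). If the
`F_k` propagate chaos on `[0, T]` with a measurable probability density `f(t)` as limit, then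
the empirical measure at each `t ∈ [0, T]` converges in probability to `f(t) dx dv`. Compared
with the prelude fact `TendstoMarginals.tendstoEmpirical` (raw transported density, mode A at
every off-diagonal point) the hypotheses are the ones a BBGKY analysis actually delivers; the
price is the measurability of `f(t)` (automatic for Lanford's continuous solutions). Standing
hypotheses on the position space as there (Hausdorff, σ-compact, Borel, Radon `volume` with
null points). [cite: Sznitman1991, Prop. 2.2 (i)⇒(ii)] -/
theorem tendstoEmpirical_of_ae_versions [T2Space X] [SigmaCompactSpace X] [BorelSpace X]
    [IsFiniteMeasureOnCompacts (volume : Measure X)] [NullSingletonClass (volume : Measure X)]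
    {G : Geometry d X} {Nk : ℕ → ℕ} {εk : ℕ → ℝ}
    (hN : Tendsto Nk atTop atTop) (Φk : (k : ℕ) → HardSphereFlow G (εk k) (Nk k))
    {Wk : (k : ℕ) → Config (Nk k) d X → ℝ} (hWs : ∀ k, IsSymmetricFn (Wk k))
    (hWm : ∀ k, Measurable (Wk k)) (hW0 : ∀ k, 0 ≤ Wk k)
    (hWD : ∀ k, ∀ z ∉ hardSphereDomain G (Nk k) (εk k), Wk k z = 0)
    (hW1 : ∀ k, ∫ z, Wk k z = 1) {f : ℝ → X × EuclideanSpace ℝ d → ℝ} {T : ℝ}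
    (hf0 : ∀ t ∈ Icc 0 T, 0 ≤ f t)
    (hf1 : ∀ t ∈ Icc 0 T, ∫ x : X, ∫ v : EuclideanSpace ℝ d, f t (x, v) = 1)
    (hfm : ∀ t ∈ Icc 0 T, Measurable (f t))
    {F : ℕ → (s : ℕ) → ℝ → Config s d X → ℝ}
    (hF : ∀ k s, ∀ t ∈ Icc 0 T, F k s t =ᵐ[volume]
      nthMarginal (Nk k) s ((Φk k).good.indicator (hsTransport (Φk k) t (Wk k))))
    (h : PropagatesChaos F f T) :
    TendstoEmpirical Nk (fun k => particleLaw (Φk k) (Wk k)) (fun k => (Φk k).flow) f T := by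
  classical
  intro t ht φ hφc hφs δ hδ
  -- notation: the laws at time `t'` and their densities
  set Q : (k : ℕ) → ℝ → Measure (Config (Nk k) d X) :=
    fun k t' => (particleLaw (Φk k) (Wk k)).map ((Φk k).flow t') with hQdef
  haveI hQ : ∀ k t', IsProbabilityMeasure (Q k t') := fun k t' =>
    isProbabilityMeasure_map_flow_particleLaw (Φk k) (hW0 k) (hWD k) (hW1 k) t'
  set ρ : (k : ℕ) → ℝ → Config (Nk k) d X → ℝ :=
    fun k t' => (Φk k).good.indicator (hsTransport (Φk k) t' (Wk k)) with hρdef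
  set c : ℝ := ∫ x : X, ∫ v : EuclideanSpace ℝ d, φ (x, v) * f t (x, v) with hc
  have hφm : Measurable φ := hφc.measurable
  obtain ⟨M, hM⟩ : ∃ M, ∀ e, |φ e| ≤ M := by
    obtain ⟨M, hM⟩ := hφs.exists_bound_of_continuous hφc
    exact ⟨M, fun e => by simpa using hM e⟩
  have hρm : ∀ k t', Measurable (ρ k t') := fun k t' =>
    ((hWm k).comp ((Φk k).measurable_flow (-t'))).indicator (Φk k).measurableSet_good
  have hρ0 : ∀ k t', 0 ≤ ρ k t' := fun k t' z => (indicator_hsTransport_le (Φk k) (hW0 k) t' z).1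
  -- the density of `Q k t'` is `ρ k t'`, a probability density
  have hρint : ∀ k t' (g : Config (Nk k) d X → ℝ), ∫ w, g w ∂Q k t' = ∫ z, g z * ρ k t' z :=
    fun k t' g => integral_map_flow_particleLaw (Φk k) (hWm k) (hW0 k) t' g
  have hρ1 : ∀ k, ∀ t' ∈ Icc 0 T, ∫ z, ρ k t' z = 1 := fun k t' _ => by
    have := hρint k t' fun _ => 1
    simp only [one_mul, integral_const, probReal_univ, smul_eq_mul, mul_one] at this
    exact this.symm
  have hρi : ∀ k, Integrable (ρ k t) := fun k => by
    by_contra hnot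
    have := hρ1 k t ht
    rw [integral_undef hnot] at this
    exact zero_ne_one this
  -- Step 3: `∫ φ^{⊗s}(z_0, …, z_{s-1}) ρ_k(z) dz → c ^ s` whenever the core theorem applies
  have hcore : ∀ s : ℕ, (∀ P : (Fin s → X) → Prop, MeasurableSet {xs | P xs} →
      (∀ xs ∈ offDiag (X := X) s, P xs) → ∀ᵐ xs : Fin s → X, P xs) →
      Tendsto (fun k => if hs : s ≤ Nk k then
        ∫ z, tensorPow s φ (fun i => z (Fin.castLE hs i)) * ρ k t z else c ^ s) atTop
        (𝓝 (c ^ s)) := by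
    intro s hnull
    have hB := tendsto_integral_tensorPow_mul_nthMarginal_ae hN (ρ := ρ) hρm hρ0 hρ1 hf0 hf1
      hfm hF h ht hφc hφs s hnull
    have hGm : Measurable (tensorPow s φ : Config s d X → ℝ) := measurable_tensorPow hφm s
    have hGb : ∀ zs : Config s d X, |tensorPow s φ zs| ≤ M ^ s := abs_tensorPow_le hM s
    refine hB.congr' ?_
    filter_upwards [hN.eventually_ge_atTop s] with k hs
    rw [dif_pos hs, ← integral_mul_nthMarginal hs (hρi k) hGm hGb]
  -- Step 4: one- and two-particle expectations via symmetry
  set a : ℕ → ℝ := fun k => if hn : 0 < Nk k then ∫ w, φ (w ⟨0, hn⟩) ∂Q k t else 0 with hadef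
  set b : ℕ → ℝ := fun k => if hn : 1 < Nk k then
    ∫ w, φ (w ⟨0, by omega⟩) * φ (w ⟨1, hn⟩) ∂Q k t else 0 with hbdef
  have hsymm : ∀ k (σ : Equiv.Perm (Fin (Nk k))) (F : Config (Nk k) d X → ℝ), Measurable F →
      ∫ w, F (w ∘ σ) ∂Q k t = ∫ w, F w ∂Q k t := fun k σ F hF =>
    integral_comp_perm_map_flow_particleLaw (Φk k) (hWs k) (hWm k) (hW0 k) (hWD k)
      ((Φk k).flow_comp_perm_ae σ t) hF
  have ha : ∀ k (i : Fin (Nk k)), ∫ w, φ (w i) ∂Q k t = a k := by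
    intro k i
    simp only [hadef, i.pos, dif_pos]
    have := hsymm k (Equiv.swap ⟨0, i.pos⟩ i) (fun w => φ (w ⟨0, i.pos⟩))
      (hφm.comp (measurable_pi_apply _))
    simpa [Function.comp, Equiv.swap_apply_left] using this
  have hb : ∀ k (i j : Fin (Nk k)), i ≠ j → ∫ w, φ (w i) * φ (w j) ∂Q k t = b k := by
    intro k i j hij
    have h1 : 1 < Nk k := by
      have : Nontrivial (Fin (Nk k)) := ⟨⟨i, j, hij⟩⟩
      exact Fin.nontrivial_iff_two_le.1 this
    simp only [hbdef, h1, dif_pos]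
    obtain ⟨σ, hσ0, hσ1⟩ := exists_perm_apply_zero_one hij h1
    have := hsymm k σ (fun w => φ (w ⟨0, by omega⟩) * φ (w ⟨1, h1⟩))
      ((hφm.comp (measurable_pi_apply _)).mul (hφm.comp (measurable_pi_apply _)))
    simpa [Function.comp, hσ0, hσ1] using this
  -- Step 5: their limits
  have ha' : Tendsto a atTop (𝓝 c) := by
    have h1 := hcore 1 (fun P _ hP => Eventually.of_forall fun xs =>
      hP xs fun i j hij => absurd (Subsingleton.elim i j) hij)
    rw [pow_one] at h1
    refine h1.congr' ?_
    filter_upwards [hN.eventually_ge_atTop 1] with k hk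
    have hn : 0 < Nk k := hk
    rw [dif_pos hk]
    simp only [hadef, dif_pos hn]
    rw [hρint k]
    refine integral_congr_ae (Eventually.of_forall fun z => ?_)
    have hidx : Fin.castLE hk 0 = ⟨0, hn⟩ := Fin.ext (by simp)
    simp only [tensorPow, Fin.prod_univ_one, hidx]
  have hb' : Tendsto b atTop (𝓝 (c ^ 2)) := by
    have h2 := hcore 2 (fun P hP hall => ae_of_forall_offDiag_two hP hall)
    refine h2.congr' ?_
    filter_upwards [hN.eventually_ge_atTop 2] with k hk
    have hn : 1 < Nk k := hk
    rw [dif_pos hk]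
    simp only [hbdef, dif_pos hn]
    rw [hρint k]
    refine integral_congr_ae (Eventually.of_forall fun z => ?_)
    have hidx0 : Fin.castLE hk 0 = ⟨0, by omega⟩ := Fin.ext (by simp)
    have hidx1 : Fin.castLE hk 1 = ⟨1, hn⟩ := Fin.ext (by simp)
    simp only [tensorPow, Fin.prod_univ_two, hidx0, hidx1]
  -- Step 6: Chebyshev (`KacChaos`) and the identification of the events
  have hK := tendsto_measure_empiricalAverage_sub hN (fun k => Q k t) hφm hM ha hb ha' hb' hδ
  refine hK.congr' (Eventually.of_forall fun k => ?_)
  have hSm : MeasurableSet {w : Config (Nk k) d X | δ < |empiricalAverage φ w - c|} :=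
    measurableSet_lt measurable_const
      ((measurable_empiricalAverage hφm).sub measurable_const).abs
  have hset : (Φk k).flow t ⁻¹' {w : Config (Nk k) d X | δ < |empiricalAverage φ w - c|} =
      {z | δ < |∫ y, φ y ∂empiricalMeasure ((Φk k).flow t z) - c|} := by
    ext z
    simp only [Set.mem_preimage, Set.mem_setOf_eq, integral_empiricalMeasure, empiricalAverage]
  simp only [hQdef]
  rw [Measure.map_apply ((Φk k).measurable_flow t) hSm, hset]

end Assembly

/-! ## The canonical partition function of Lanford data on `T^d` is eventually positive -/

section Partition

variable {d : Type*} [Fintype d]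

local notation "𝔼" => EuclideanSpace ℝ d
local notation "𝕋" => UnitAddTorus d

attribute [local instance] sigmaFinite_volume_phaseSpace

variable {ε β C : ℝ} {n : ℕ}

/-- A density dominated by a multiple of the Maxwellian is integrable on `T^d × ℝ^d`.
[folklore] -/
theorem integrable_of_le_maxwellianBeta {f₀ : 𝕋 × 𝔼 → ℝ} (hβ : 0 < β) (hf₀m : Measurable f₀)
    (hf₀0 : 0 ≤ f₀) (hf₀b : ∀ z, f₀ z ≤ C * maxwellianBeta β z.2) : Integrable f₀ := by
  have h1 : Integrable (fun z : 𝕋 × 𝔼 => C * maxwellianBeta β z.2) := by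
    have := ((integrable_maxwellianBeta (d := d) hβ).comp_snd (volume : Measure 𝕋)).const_mul C
    rw [← Measure.volume_eq_prod] at this
    exact this
  refine h1.mono' hf₀m.aestronglyMeasurable (Eventually.of_forall fun z => ?_)
  rw [Real.norm_eq_abs, abs_of_nonneg (hf₀0 z)]
  exact hf₀b z

/-- The velocity marginal of a density dominated by `C M_β` is at most `C` at every position.
[folklore] -/
theorem integral_section_le {f₀ : 𝕋 × 𝔼 → ℝ} (hβ : 0 < β) (hC : 0 ≤ C)
    (hf₀b : ∀ z, f₀ z ≤ C * maxwellianBeta β z.2) (x : 𝕋) : ∫ v, f₀ (x, v) ≤ C := by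
  have h1 : Integrable (fun v : 𝔼 => C * maxwellianBeta β v) :=
    (integrable_maxwellianBeta hβ).const_mul C
  by_cases hi : Integrable (fun v : 𝔼 => f₀ (x, v))
  · calc ∫ v, f₀ (x, v) ≤ ∫ v : 𝔼, C * maxwellianBeta β v := integral_mono hi h1 fun v => hf₀b _
      _ = C := by rw [integral_const_mul, integral_maxwellianBeta hβ, mul_one]
  · rw [integral_undef hi]
    exact hC

/-- Fubini against a function of the position only: for `g` bounded measurable on `T^d` and
`f₀` integrable, `∫ g(x) f₀(x, v) d(x, v) = ∫ g(x) (∫ f₀(x, v) dv) dx`. [folklore] -/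
theorem integral_fst_mul_eq {f₀ : 𝕋 × 𝔼 → ℝ} (hf₀i : Integrable f₀) {g : 𝕋 → ℝ}
    (hgm : Measurable g) {B : ℝ} (hgb : ∀ x, |g x| ≤ B) :
    ∫ z, g z.1 * f₀ z = ∫ x, g x * ∫ v, f₀ (x, v) := by
  have hint : Integrable (fun z : 𝕋 × 𝔼 => g z.1 * f₀ z) :=
    hf₀i.bdd_mul (hgm.comp measurable_fst).aestronglyMeasurable
      (Eventually.of_forall fun z => by simpa [Real.norm_eq_abs] using hgb z.1)
  rw [Measure.volume_eq_prod] at hint ⊢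
  rw [integral_prod _ hint]
  refine integral_congr_ae (Eventually.of_forall fun x => ?_)
  change ∫ v, g x * f₀ (x, v) = g x * ∫ v, f₀ (x, v)
  exact integral_const_mul _ _

/-- **The exclusion step of GST 2013 Prop. 6.1.1 / BGSR Appendix A on `T^d`**: for a
nonnegative density `f₀` with `∫ f₀ = 1` and velocity marginal `∫ f₀(x, v) dv ≤ C`, integrating
out a particle adjoined to a configuration `Z'` of `n` spheres costs at most the excluded
volume: `∫ 1_{D_ε^{n+1}} f₀^{⊗(n+1)}(z₀, Z') dz₀ ≥ (1 - n (2ε)^d C) 1_{D_ε^n} f₀^{⊗n}(Z')`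
(GST print `κ_d ε^d |f₀|_{L^∞L^1}` for the excluded mass on `ℝ^d`; on the unit torus the ball of
radius `ε ≤ 1/2` has volume `≤ (2ε)^d`). [cite: GST2013, Prop. 6.1.1] -/
theorem integral_indicator_tensorPow_cons_ge {f₀ : 𝕋 × 𝔼 → ℝ} (hβ : 0 < β) (hC : 0 ≤ C)
    (hε : 0 ≤ ε) (hf₀m : Measurable f₀) (hf₀0 : 0 ≤ f₀)
    (hf₀b : ∀ z, f₀ z ≤ C * maxwellianBeta β z.2) (hf₀1 : ∫ z, f₀ z = 1) (zm : Config n d 𝕋) :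
    (1 - n * (2 * ε) ^ Fintype.card d * C) * (hardSphereDomain (Torus.geometry d) n ε).indicator
        (tensorPow n f₀) zm ≤
      ∫ y : 𝕋 × 𝔼, (hardSphereDomain (Torus.geometry d) (n + 1) ε).indicator
        (tensorPow (n + 1) f₀) (Fin.cons y zm) := by
  have hf₀i : Integrable f₀ := integrable_of_le_maxwellianBeta hβ hf₀m hf₀0 hf₀b
  have hTn0 : 0 ≤ tensorPow n f₀ zm := tensorPow_nonneg hf₀0 n zm
  have hT0 : ∀ w : Config (n + 1) d 𝕋, 0 ≤ tensorPow (n + 1) f₀ w :=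
    fun w => tensorPow_nonneg hf₀0 (n + 1) w
  by_cases hzm : zm ∈ hardSphereDomain (Torus.geometry d) n ε
  swap
  · rw [indicator_of_notMem hzm, mul_zero]
    exact integral_nonneg fun y => Set.indicator_nonneg (fun w _ => hT0 w) _
  rw [indicator_of_mem hzm]
  set S : Set 𝕋 := {x : 𝕋 | ∀ j, ε ≤ Torus.euclidDist x (zm j).1} with hS
  have hS_meas : MeasurableSet S := measurableSet_setOf_forall_le_euclidDist zm ε
  -- pointwise lower bound `1_S(x) f₀(z₀) Tₙ(Z') ≤ 1_D T(z₀, Z')`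
  have hlow : ∀ y : 𝕋 × 𝔼, S.indicator (fun _ => (1 : ℝ)) y.1 * f₀ y * tensorPow n f₀ zm ≤
      (hardSphereDomain (Torus.geometry d) (n + 1) ε).indicator
        (tensorPow (n + 1) f₀) (Fin.cons y zm) := by
    intro y
    by_cases hy : y.1 ∈ S
    · rw [indicator_of_mem hy, one_mul, indicator_of_mem (cons_mem_hardSphereDomain hzm hy),
        tensorPow_cons]
    · rw [indicator_of_notMem hy, zero_mul, zero_mul]
      exact Set.indicator_nonneg (fun w _ => hT0 w) _
  -- the mass of `f₀` over `S`: `∫ 1_S f₀ = 1 - ∫ 1_{Sᶜ} f₀ ≥ 1 - |Sᶜ| C`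
  have hSc_int : ∫ y : 𝕋 × 𝔼, Sᶜ.indicator (fun _ => (1 : ℝ)) y.1 * f₀ y ≤
      n * (2 * ε) ^ Fintype.card d * C := by
    rw [integral_fst_mul_eq hf₀i (g := fun x => Sᶜ.indicator (fun _ => (1 : ℝ)) x)
      (measurable_const.indicator hS_meas.compl) (B := 1)
      (fun x => by by_cases hx : x ∈ Sᶜ <;> simp [hx])]
    have hvol : (volume : Measure 𝕋).real Sᶜ ≤ n * (2 * ε) ^ Fintype.card d := by
      have h1 := volume_real_setOf_forall_le_euclidDist_ge hε zm
      have h2 : (volume : Measure 𝕋).real S + (volume : Measure 𝕋).real Sᶜ = 1 := by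
        rw [measureReal_add_measureReal_compl hS_meas, probReal_univ]
      rw [← hS] at h1
      linarith
    calc ∫ x, Sᶜ.indicator (fun _ => (1 : ℝ)) x * ∫ v, f₀ (x, v)
        ≤ ∫ x, Sᶜ.indicator (fun _ => (1 : ℝ)) x * C := by
          have hiC : Integrable (fun x : 𝕋 => Sᶜ.indicator (fun _ => (1 : ℝ)) x * C) := by
            refine ((integrable_const C).indicator hS_meas.compl).congr
              (Eventually.of_forall fun x => ?_)
            by_cases hx : x ∈ Sᶜ
            · simp [indicator_of_mem hx]
            · simp [indicator_of_notMem hx]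
          refine integral_mono_of_nonneg (Eventually.of_forall fun x => mul_nonneg
            (Set.indicator_nonneg (fun _ _ => zero_le_one) _)
            (integral_nonneg fun v => hf₀0 _)) hiC
            (Eventually.of_forall fun x => ?_)
          exact mul_le_mul_of_nonneg_left (integral_section_le hβ hC hf₀b x)
            (Set.indicator_nonneg (fun _ _ => zero_le_one) _)
      _ = (volume : Measure 𝕋).real Sᶜ * C := by
          rw [integral_mul_const]
          congr 1
          exact integral_indicator_one hS_meas.compl
      _ ≤ n * (2 * ε) ^ Fintype.card d * C := mul_le_mul_of_nonneg_right hvol hC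
  have hS_int : 1 - n * (2 * ε) ^ Fintype.card d * C ≤
      ∫ y : 𝕋 × 𝔼, S.indicator (fun _ => (1 : ℝ)) y.1 * f₀ y := by
    have hsplit : ∀ y : 𝕋 × 𝔼, S.indicator (fun _ => (1 : ℝ)) y.1 * f₀ y =
        f₀ y - Sᶜ.indicator (fun _ => (1 : ℝ)) y.1 * f₀ y := by
      intro y
      by_cases hy : y.1 ∈ S
      · have hy' : y.1 ∉ Sᶜ := fun h => h hy
        simp [indicator_of_mem hy, indicator_of_notMem hy']
      · have hy' : y.1 ∈ Sᶜ := hy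
        simp [indicator_of_notMem hy, indicator_of_mem hy']
    have hci : Integrable (fun y : 𝕋 × 𝔼 => Sᶜ.indicator (fun _ => (1 : ℝ)) y.1 * f₀ y) :=
      hf₀i.bdd_mul ((measurable_const.indicator hS_meas.compl).comp measurable_fst).aestronglyMeasurable
        (Eventually.of_forall fun y =>
          (show ‖Sᶜ.indicator (fun _ => (1 : ℝ)) y.1‖ ≤ 1 by
            by_cases hy : y.1 ∈ Sᶜ
            · simp [indicator_of_mem hy]
            · simp [indicator_of_notMem hy]))
    simp_rw [hsplit]
    rw [integral_sub hf₀i hci, hf₀1]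
    linarith
  calc (1 - n * (2 * ε) ^ Fintype.card d * C) * tensorPow n f₀ zm
      ≤ (∫ y : 𝕋 × 𝔼, S.indicator (fun _ => (1 : ℝ)) y.1 * f₀ y) * tensorPow n f₀ zm :=
        mul_le_mul_of_nonneg_right hS_int hTn0
    _ = ∫ y : 𝕋 × 𝔼, S.indicator (fun _ => (1 : ℝ)) y.1 * f₀ y * tensorPow n f₀ zm :=
        (integral_mul_const _ _).symm
    _ ≤ ∫ y : 𝕋 × 𝔼, (hardSphereDomain (Torus.geometry d) (n + 1) ε).indicator
          (tensorPow (n + 1) f₀) (Fin.cons y zm) := by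
        refine integral_mono_of_nonneg (Eventually.of_forall fun y => mul_nonneg (mul_nonneg
          (Set.indicator_nonneg (fun _ _ => zero_le_one) _) (hf₀0 _)) hTn0) ?_
          (Eventually.of_forall hlow)
        -- integrability of the right-hand side: dominated by `f₀(z₀) Tₙ(Z')`
        have hcons : Measurable fun y : 𝕋 × 𝔼 => (Fin.cons y zm : Config (n + 1) d 𝕋) :=
          measurable_finCons.comp (measurable_id.prodMk measurable_const)
        have hm : Measurable fun y : 𝕋 × 𝔼 => (hardSphereDomain (Torus.geometry d) (n + 1) ε).indicator
            (tensorPow (n + 1) f₀) (Fin.cons y zm) :=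
          ((measurable_tensorPow hf₀m (n + 1)).indicator
            (measurableSet_hardSphereDomain_torus (n + 1) ε)).comp hcons
        refine Integrable.mono' (hf₀i.mul_const (tensorPow n f₀ zm)) hm.aestronglyMeasurable
          (Eventually.of_forall fun y => ?_)
        rw [Real.norm_eq_abs, abs_of_nonneg (Set.indicator_nonneg (fun w _ => hT0 w) _)]
        exact (Set.indicator_le_self' (fun w _ => hT0 w) _).trans_eq (tensorPow_cons _ y zm)

/-- Tensor powers of an integrable one-particle function are integrable on `(T^d × ℝ^d)^n`.
[folklore] -/
theorem integrable_tensorPow {f₀ : 𝕋 × 𝔼 → ℝ} (hf₀i : Integrable f₀) (n : ℕ) :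
    Integrable (tensorPow n f₀ : Config n d 𝕋 → ℝ) :=
  Integrable.fintype_prod (f := fun _ : Fin n => f₀) fun _ => hf₀i

/-- `𝒵_{n+1}` by integrating out the adjoined particle last (Fubini):
`𝒵_{n+1} = ∫ dZ' ∫ dz₀ 1_{D_ε^{n+1}} f₀^{⊗(n+1)}(z₀, Z')` (GST 2013 Prop. 6.1.1, proof).
[cite: GST2013, Prop. 6.1.1] -/
theorem canonicalPartition_succ_eq_integral_integral {f₀ : 𝕋 × 𝔼 → ℝ}
    (hf₀i : Integrable f₀) (n : ℕ) :
    canonicalPartition (Torus.geometry d) ε (n + 1) f₀ =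
      ∫ zm : Config n d 𝕋, ∫ y : 𝕋 × 𝔼, (hardSphereDomain (Torus.geometry d) (n + 1) ε).indicator
        (tensorPow (n + 1) f₀) (Fin.cons y zm) := by
  have hes : MeasurePreserving
      (MeasurableEquiv.piFinSuccAbove (fun _ : Fin (n + 1) => 𝕋 × 𝔼) 0).symm volume volume :=
    (volume_preserving_piFinSuccAbove (fun _ : Fin (n + 1) => 𝕋 × 𝔼) 0).symm _
  have hint : Integrable ((hardSphereDomain (Torus.geometry d) (n + 1) ε).indicator
      (tensorPow (n + 1) f₀)) :=
    (integrable_tensorPow hf₀i (n + 1)).indicator (measurableSet_hardSphereDomain_torus (n + 1) ε)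
  have hint' : Integrable (fun p : (𝕋 × 𝔼) × Config n d 𝕋 =>
      (hardSphereDomain (Torus.geometry d) (n + 1) ε).indicator (tensorPow (n + 1) f₀)
        ((MeasurableEquiv.piFinSuccAbove (fun _ : Fin (n + 1) => 𝕋 × 𝔼) 0).symm p))
      ((volume : Measure (𝕋 × 𝔼)).prod (volume : Measure (Config n d 𝕋))) :=
    (hes.integrable_comp_emb (MeasurableEquiv.measurableEmbedding _)).2 hint
  rw [canonicalPartition, ← hes.integral_comp']
  change ∫ p, (hardSphereDomain (Torus.geometry d) (n + 1) ε).indicator (tensorPow (n + 1) f₀)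
      ((MeasurableEquiv.piFinSuccAbove (fun _ : Fin (n + 1) => 𝕋 × 𝔼) 0).symm p)
    ∂(volume : Measure (𝕋 × 𝔼)).prod (volume : Measure (Config n d 𝕋)) = _
  rw [integral_prod_symm _ hint']
  simp only [piFinSuccAbove_zero_symm_apply]

/-- The inner integral of the previous lemma is integrable in the background `Z'`. [folklore] -/
theorem integrable_integral_indicator_tensorPow_cons {f₀ : 𝕋 × 𝔼 → ℝ} (hf₀i : Integrable f₀)
    (n : ℕ) :
    Integrable fun zm : Config n d 𝕋 => ∫ y : 𝕋 × 𝔼,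
      (hardSphereDomain (Torus.geometry d) (n + 1) ε).indicator
        (tensorPow (n + 1) f₀) (Fin.cons y zm) := by
  have hes : MeasurePreserving
      (MeasurableEquiv.piFinSuccAbove (fun _ : Fin (n + 1) => 𝕋 × 𝔼) 0).symm volume volume :=
    (volume_preserving_piFinSuccAbove (fun _ : Fin (n + 1) => 𝕋 × 𝔼) 0).symm _
  have hint : Integrable ((hardSphereDomain (Torus.geometry d) (n + 1) ε).indicator
      (tensorPow (n + 1) f₀)) :=
    (integrable_tensorPow hf₀i (n + 1)).indicator (measurableSet_hardSphereDomain_torus (n + 1) ε)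
  have hint' : Integrable (fun p : (𝕋 × 𝔼) × Config n d 𝕋 =>
      (hardSphereDomain (Torus.geometry d) (n + 1) ε).indicator (tensorPow (n + 1) f₀)
        ((MeasurableEquiv.piFinSuccAbove (fun _ : Fin (n + 1) => 𝕋 × 𝔼) 0).symm p))
      ((volume : Measure (𝕋 × 𝔼)).prod (volume : Measure (Config n d 𝕋))) :=
    (hes.integrable_comp_emb (MeasurableEquiv.measurableEmbedding _)).2 hint
  refine hint'.integral_prod_right.congr (Eventually.of_forall fun zm => ?_)
  simp only [piFinSuccAbove_zero_symm_apply]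

/-- **GST 2013 Prop. 6.1.1, one step, on `T^d`**: `𝒵_{n+1} ≥ (1 - n (2ε)^d C) 𝒵_n` for the
hard-sphere partition functions of a probability density `f₀` on `T^d × ℝ^d` with velocity
marginal `≤ C` (printed: `𝒵_{s+1} ≥ 𝒵_s (1 - κ_d s ε^d |f₀|_{L^∞L^1})`; BGSR 2016 Appendix A
(A.1) for the torus). [cite: GST2013, Prop. 6.1.1] -/
theorem canonicalPartition_succ_ge {f₀ : 𝕋 × 𝔼 → ℝ} (hβ : 0 < β) (hC : 0 ≤ C) (hε : 0 ≤ ε)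
    (hf₀m : Measurable f₀) (hf₀0 : 0 ≤ f₀) (hf₀b : ∀ z, f₀ z ≤ C * maxwellianBeta β z.2)
    (hf₀1 : ∫ z, f₀ z = 1) (n : ℕ) :
    (1 - n * (2 * ε) ^ Fintype.card d * C) * canonicalPartition (Torus.geometry d) ε n f₀ ≤
      canonicalPartition (Torus.geometry d) ε (n + 1) f₀ := by
  have hf₀i : Integrable f₀ := integrable_of_le_maxwellianBeta hβ hf₀m hf₀0 hf₀b
  rw [canonicalPartition_succ_eq_integral_integral hf₀i n, canonicalPartition,
    ← integral_const_mul]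
  exact integral_mono (((integrable_tensorPow hf₀i n).indicator
      (measurableSet_hardSphereDomain_torus n ε)).const_mul _)
    (integrable_integral_indicator_tensorPow_cons hf₀i n)
    fun zm => integral_indicator_tensorPow_cons_ge hβ hC hε hf₀m hf₀0 hf₀b hf₀1 zm

/-- **Positivity of the partition functions for small excluded volume** (GST 2013 Prop. 6.1.1:
`1 ≤ 𝒵_N⁻¹ 𝒵_{N-s} ≤ (1 - ε κ_d |f₀|_{L^∞L^1})^{-s}`, in particular `𝒵_N > 0`): if
`N (2ε)^d C < 1` then `𝒵_m > 0` for all `m ≤ N`. [cite: GST2013, Prop. 6.1.1] -/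
theorem canonicalPartition_pos_of_lt {f₀ : 𝕋 × 𝔼 → ℝ} (hβ : 0 < β) (hC : 0 ≤ C) (hε : 0 ≤ ε)
    (hf₀m : Measurable f₀) (hf₀0 : 0 ≤ f₀) (hf₀b : ∀ z, f₀ z ≤ C * maxwellianBeta β z.2)
    (hf₀1 : ∫ z, f₀ z = 1) {N : ℕ} (hN : (N : ℝ) * (2 * ε) ^ Fintype.card d * C < 1) :
    ∀ m ≤ N, 0 < canonicalPartition (Torus.geometry d) ε m f₀ := by
  intro m
  induction m with
  | zero => intro; rw [canonicalPartition_zero]; exact one_pos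
  | succ m ih =>
    intro hm
    have hm' : (m : ℝ) * (2 * ε) ^ Fintype.card d * C < 1 := by
      refine lt_of_le_of_lt ?_ hN
      have hmN : (m : ℝ) ≤ N := by exact_mod_cast (Nat.le_of_succ_le hm)
      have h0 : 0 ≤ (2 * ε) ^ Fintype.card d * C := by positivity
      nlinarith
    exact lt_of_lt_of_le (mul_pos (by linarith) (ih (Nat.le_of_succ_le hm)))
      (canonicalPartition_succ_ge hβ hC hε hf₀m hf₀0 hf₀b hf₀1 m)

/-- **The canonical partition function is eventually positive along an exact Boltzmann–Grad
sequence** (GST 2013 Prop. 6.1.1 in the scaling `N ε^{d-1} ≡ 1`: the excluded mass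
`N (2ε)^d C = 2^d C ε → 0`): for a probability density `f₀ ≤ C M_β` on `T^d × ℝ^d`, `d ≥ 2`, and
`N_k ε_k^{d-1} = 1`, `ε_k → 0⁺`, eventually `𝒵_{N_k}(f₀) > 0`, so that the canonical Gibbs-type
datum `𝒵_N⁻¹ 1_{D_ε^N} f₀^{⊗N}` (`canonicalDensity`) is eventually a genuine probability density
(for finitely many `k` it may be the junk `0`). [cite: GST2013, Prop. 6.1.1] -/
theorem canonicalPartition_eventually_pos (hd : 2 ≤ Fintype.card d) {f₀ : 𝕋 × 𝔼 → ℝ}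
    (hβ : 0 < β) (hC : 0 ≤ C) (hf₀m : Measurable f₀) (hf₀0 : 0 ≤ f₀)
    (hf₀b : ∀ z, f₀ z ≤ C * maxwellianBeta β z.2) (hf₀1 : ∫ z, f₀ z = 1)
    {N : ℕ → ℕ} {εk : ℕ → ℝ} (hNε : IsBoltzmannGradSequenceExact d 1 N εk) :
    ∀ᶠ k in atTop, 0 < canonicalPartition (Torus.geometry d) (εk k) (N k) f₀ := by
  obtain ⟨hpos, hε0, hexact⟩ := hNε
  obtain ⟨c, hc⟩ : ∃ c, Fintype.card d = c + 1 := ⟨Fintype.card d - 1, by omega⟩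
  -- the excluded mass `N_k (2 ε_k)^d C = 2^d C ε_k` tends to `0`
  have hbound : ∀ k, (N k : ℝ) * (2 * εk k) ^ Fintype.card d * C = 2 ^ Fintype.card d * C * εk k := by
    intro k
    have hk : (N k : ℝ) * εk k ^ c = 1 := by
      have h := hexact k
      simp only [hc, Nat.add_sub_cancel] at h
      exact h
    rw [hc]
    calc (N k : ℝ) * (2 * εk k) ^ (c + 1) * C
        = 2 ^ (c + 1) * C * ((N k : ℝ) * εk k ^ c) * εk k := by rw [mul_pow, pow_succ (εk k)]; ring
      _ = 2 ^ (c + 1) * C * εk k := by rw [hk, mul_one]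
  have hsmall : ∀ᶠ k in atTop, (N k : ℝ) * (2 * εk k) ^ Fintype.card d * C < 1 := by
    have ht : Tendsto (fun k => 2 ^ Fintype.card d * C * εk k) atTop (𝓝 0) := by
      simpa using hε0.const_mul (2 ^ Fintype.card d * C)
    filter_upwards [ht.eventually (Iio_mem_nhds one_pos)] with k hk
    exact (hbound k).trans_lt hk
  filter_upwards [hsmall] with k hk
  exact canonicalPartition_pos_of_lt hβ hC (hpos k).le hf₀m hf₀0 hf₀b hf₀1 hk (N k) le_rfl

end Partition

/-! ## The canonical Gibbs-type datum of a Lanford datum on `T^d` -/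

section Canonical

variable {d : Type*} [Fintype d]

local notation "𝔼" => EuclideanSpace ℝ d
local notation "𝕋" => UnitAddTorus d

attribute [local instance] sigmaFinite_volume_phaseSpace

/-- The Gaussian weight of Lanford's norm is a multiple of the Maxwellian:
`e^{-β|v|²/2} = (2π/β)^{d/2} M_β(v)`. [folklore] -/
theorem exp_neg_eq_mul_maxwellianBeta {β : ℝ} (hβ : 0 < β) (v : 𝔼) :
    Real.exp (-(β / 2) * ‖v‖ ^ 2) =
      (2 * Real.pi * β⁻¹) ^ ((Module.finrank ℝ 𝔼 : ℝ) / 2) * maxwellianBeta β v := by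
  rw [maxwellianBeta_eq, ← mul_assoc]
  have hb : 0 < 2 * Real.pi * β⁻¹ := by positivity
  rw [show -(Module.finrank ℝ 𝔼 : ℝ) / 2 = -((Module.finrank ℝ 𝔼 : ℝ) / 2) by ring,
    Real.rpow_neg hb.le, mul_inv_cancel₀ (Real.rpow_pos_of_pos hb _).ne', one_mul]

/-- *A Lanford datum, uncurried, is a measurable nonnegative density dominated by a multiple of
the Maxwellian* (`0 ≤ f₀ ≤ C₀ e^{-β₀|v|²/2} = C₀ (2π/β₀)^{d/2} M_{β₀}`). [folklore] -/
theorem isLanfordDatum_uncurry {β₀ C₀ : ℝ} (hβ₀ : 0 < β₀) (hC₀ : 0 ≤ C₀) {f₀ : 𝕋 → 𝔼 → ℝ}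
    (hf₀ : IsLanfordDatum β₀ C₀ f₀) :
    Measurable (uncurry f₀) ∧ 0 ≤ uncurry f₀ ∧
      ∀ z : 𝕋 × 𝔼, uncurry f₀ z ≤
        C₀ * (2 * Real.pi * β₀⁻¹) ^ ((Module.finrank ℝ 𝔼 : ℝ) / 2) * maxwellianBeta β₀ z.2 := by
  obtain ⟨h0, hmem, hnorm⟩ := hf₀
  refine ⟨hmem.1.measurable, fun z => h0 z.1 z.2, fun z => ?_⟩
  have h := abs_le_of_eGaussSupNorm_le hC₀ hnorm z.1 z.2
  rw [exp_neg_eq_mul_maxwellianBeta hβ₀, ← mul_assoc] at h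
  exact (le_abs_self _).trans h

/-- A Lanford datum with `∫_{T^d} ∫ f₀ dv dx = 1` has, uncurried, total integral `1` on
`T^d × ℝ^d` (Fubini; the datum is integrable). [folklore] -/
theorem integral_uncurry_eq_one {β₀ C₀ : ℝ} (hβ₀ : 0 < β₀) (hC₀ : 0 ≤ C₀) {f₀ : 𝕋 → 𝔼 → ℝ}
    (hf₀ : IsLanfordDatum β₀ C₀ f₀) (h1 : ∫ x, ∫ v, f₀ x v = 1) :
    ∫ z, uncurry f₀ z = 1 := by
  obtain ⟨hm, h0, hb⟩ := isLanfordDatum_uncurry hβ₀ hC₀ hf₀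
  have hi : Integrable (uncurry f₀) := integrable_of_le_maxwellianBeta hβ₀ hm h0 hb
  rw [Measure.volume_eq_prod] at hi ⊢
  rw [integral_prod _ hi]
  exact h1

variable {ε : ℝ} {N : ℕ}

/-- The canonical Gibbs-type density is a symmetric function of the particles. [folklore] -/
theorem isSymmetricFn_canonicalDensity (f₀ : 𝕋 × 𝔼 → ℝ) :
    IsSymmetricFn (canonicalDensity (Torus.geometry d) ε N f₀) := by
  intro σ z
  have h := isSymmetricFn_tensorPow N f₀ σ z
  have hD := comp_perm_mem_hardSphereDomain_iff (Torus.geometry d) ε σ z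
  simp only [canonicalDensity]
  congr 1
  by_cases hz : z ∈ hardSphereDomain (Torus.geometry d) N ε
  · rw [indicator_of_mem hz, indicator_of_mem (hD.2 hz), h]
  · rw [Set.indicator_of_notMem hz, Set.indicator_of_notMem (mt hD.1 hz)]

/-- The canonical Gibbs-type density of a measurable `f₀` is measurable. [folklore] -/
theorem measurable_canonicalDensity' {f₀ : 𝕋 × 𝔼 → ℝ} (hf₀m : Measurable f₀) :
    Measurable (canonicalDensity (Torus.geometry d) ε N f₀) :=
  ((measurable_tensorPow hf₀m N).indicator (measurableSet_hardSphereDomain_torus N ε)).const_mul _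

/-- The canonical Gibbs-type density of a nonnegative `f₀` is nonnegative. [folklore] -/
theorem canonicalDensity_nonneg' {f₀ : 𝕋 × 𝔼 → ℝ} (hf₀0 : 0 ≤ f₀) :
    0 ≤ canonicalDensity (Torus.geometry d) ε N f₀ := by
  intro z
  have hZ : 0 ≤ canonicalPartition (Torus.geometry d) ε N f₀ :=
    integral_nonneg fun w => Set.indicator_nonneg (fun w _ => tensorPow_nonneg hf₀0 N w) _
  exact mul_nonneg (inv_nonneg.2 hZ)
    (Set.indicator_nonneg (fun w _ => tensorPow_nonneg hf₀0 N w) _)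

/-- The canonical Gibbs-type density vanishes off the hard-sphere domain. [folklore] -/
theorem canonicalDensity_eq_zero_of_notMem' (f₀ : 𝕋 × 𝔼 → ℝ) {z : Config N d 𝕋}
    (hz : z ∉ hardSphereDomain (Torus.geometry d) N ε) :
    canonicalDensity (Torus.geometry d) ε N f₀ z = 0 := by
  simp [canonicalDensity, Set.indicator_of_notMem hz]

/-- The canonical Gibbs-type density is a probability density when `𝒵_N ≠ 0`
(GST 2013 (6.1.2)–(6.1.3)). [cite: GST2013, (6.1.2)–(6.1.3)] -/
theorem integral_canonicalDensity' (f₀ : 𝕋 × 𝔼 → ℝ)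
    (hZ : canonicalPartition (Torus.geometry d) ε N f₀ ≠ 0) :
    ∫ z, canonicalDensity (Torus.geometry d) ε N f₀ z = 1 := by
  simp only [canonicalDensity, integral_const_mul]
  exact inv_mul_cancel₀ hZ

end Canonical

/-! ## Shifting a sequence in mode A -/

section Shift

variable {d : Type*} {X : Type*} [Fintype d] [TopologicalSpace X]

/-- Mode-A convergence is preserved under dropping finitely many terms of the sequence. [folklore] -/
theorem tendstoMarginals_shift
    {Fk : ℕ → (s : ℕ) → ℝ → Config s d X → ℝ} {F : (s : ℕ) → ℝ → Config s d X → ℝ} {T : ℝ}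
    (h : TendstoMarginals Fk F T) (k₀ : ℕ) :
    TendstoMarginals (fun k => Fk (k + k₀)) F T :=
  fun s φ hφ hφs K hK hKc => (h s φ hφ hφs K hK hKc).comp (tendsto_add_atTop_nat k₀)

end Shift

end LanfordEmpirical

/-! ## Lanford's theorem in mode B for the canonical ensemble, from mode A -/

section LanfordEmpiricalAssembly

variable {d : Type*} [Fintype d]

open LanfordEmpirical

/-- **Reduction of `lanford_tendstoEmpirical` (hilbert6.S08, Lanford's theorem in mode B for the
canonical ensemble) to Lanford's theorem in mode A for the canonical ensemble.** Hypothesis `H`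
is Lanford's theorem for hard spheres on `T^d` with *canonical* Gibbs-type data
`𝒵_N⁻¹ 1_{D_ε^N} f₀^{⊗N}` in the exact Boltzmann–Grad scaling `N ε^{d-1} = 1`
(Gallagher–Saint-Raymond–Texier 2013 Thm 8 with the conditioned data of §6.1, (6.1.2)–(6.1.3),
Prop. 6.1.2; Lanford 1975; CIP 1994 Thm 4.4.1), in the form a BBGKY analysis delivers it: for
every Lanford datum `f₀` of mass one there is a mild solution `f ∈ C([0,T]; X_{β₀/2})` of the
hard-sphere Boltzmann equation with `f(0) = f₀` such that, along every exact Boltzmann–Grad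
sequence and for all hard-sphere flows, *versions* of the marginals of the good-set-restricted
transported canonical densities (the objects of `Literature.Analysis.FluidPDE.liouville_imp_bbgky`)
propagate chaos on `[0, T]` with limit `f` (mode A, `Literature.Analysis.FluidPDE.PropagatesChaos`).
**`H` is NOT proved here** (it is the content of GST 2013 Part II–IV and is absent from the
library); this theorem is the complete remaining glue: eventual positivity of the partition
functions `𝒵_{N_k}` (`LanfordEmpirical.canonicalPartition_eventually_pos`, GST Prop. 6.1.1, so
that the canonical data are eventually genuine symmetric probability densities supported in
`D_ε^N`), conservation of mass of the Boltzmann solution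
(`IsMildBoltzmannSolutionOn.totalMass_eq_holds`, so that `f(t)` stays a probability density),
`N_k → ∞`, and mode A (for versions) ⇒ mode B
(`LanfordEmpirical.tendstoEmpirical_of_ae_versions`, Sznitman 1991 Prop. 2.2) applied to the
sequence with its finitely many degenerate initial terms dropped. [cite: GST2013, Thm 8 and §6.1 Prop. 6.1.1–6.1.2] -/
theorem lanford_tendstoEmpirical_of_canonicalChaos
    (H : ∀ [Nonempty d] (_hd : 2 ≤ Fintype.card d) {β₀ C₀ : ℝ} (_hβ₀ : 0 < β₀) (_hC₀ : 0 < C₀),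
      ∃ T > (0 : ℝ), ∀ f₀ : UnitAddTorus d → EuclideanSpace ℝ d → ℝ, IsLanfordDatum β₀ C₀ f₀ →
        ∫ x, ∫ v, f₀ x v = 1 →
        ∃ f : ℝ → UnitAddTorus d → EuclideanSpace ℝ d → ℝ,
          ContinuousInLanfordOn (Icc 0 T) (β₀ / 2) f ∧
          IsMildBoltzmannSolutionOn T (Torus.geometry d) hardSphereKernel f ∧ f 0 = f₀ ∧
          ∀ (N : ℕ → ℕ) (ε : ℕ → ℝ), IsBoltzmannGradSequenceExact d 1 N ε → (∀ k, ε k < 2⁻¹) →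
            ∀ Φ : (k : ℕ) → HardSphereFlow (Torus.geometry d) (ε k) (N k),
              ∃ F : ℕ → (s : ℕ) → ℝ → Config s d (UnitAddTorus d) → ℝ,
                (∀ k s, ∀ t ∈ Icc 0 T, F k s t =ᵐ[volume] nthMarginal (N k) s
                  ((Φ k).good.indicator (hsTransport (Φ k) t
                    (canonicalDensity (Torus.geometry d) (ε k) (N k) (uncurry f₀))))) ∧
                PropagatesChaos F (fun t z => f t z.1 z.2) T) :
    lanford_tendstoEmpirical (d := d) := by
  intro _ hd β₀ C₀ hβ₀ hC₀
  obtain ⟨T, hT, hH⟩ := H hd hβ₀ hC₀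
  refine ⟨T, hT, fun f₀ hf₀ hf₀1 => ?_⟩
  obtain ⟨f, hcont, hmild, hf0eq, hseq⟩ := hH f₀ hf₀ hf₀1
  refine ⟨f, hcont, hmild, hf0eq, fun N ε hNε hεhalf Φ => ?_⟩
  obtain ⟨F, hF, hchaos⟩ := hseq N ε hNε hεhalf Φ
  haveI := nullSingletonClass_volume_unitAddTorus d
  -- the datum, uncurried
  set F₀ : UnitAddTorus d × EuclideanSpace ℝ d → ℝ := uncurry f₀ with hF₀def
  obtain ⟨hF₀m, hF₀0, hF₀b⟩ := isLanfordDatum_uncurry hβ₀ hC₀.le hf₀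
  have hCK : 0 ≤ C₀ * (2 * Real.pi * β₀⁻¹) ^ ((Module.finrank ℝ (EuclideanSpace ℝ d) : ℝ) / 2) :=
    mul_nonneg hC₀.le (Real.rpow_nonneg (by positivity) _)
  have hF₀1 : ∫ z, F₀ z = 1 := integral_uncurry_eq_one hβ₀ hC₀.le hf₀ hf₀1
  -- the canonical data and their eventual normalisation
  set W : (k : ℕ) → Config (N k) d (UnitAddTorus d) → ℝ :=
    fun k => canonicalDensity (Torus.geometry d) (ε k) (N k) F₀ with hWdef
  have hZpos : ∀ᶠ k in atTop, 0 < canonicalPartition (Torus.geometry d) (ε k) (N k) F₀ :=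
    canonicalPartition_eventually_pos hd hβ₀ hCK hF₀m hF₀0 hF₀b hF₀1 hNε
  obtain ⟨k₀, hk₀⟩ := eventually_atTop.1 hZpos
  have hNtop : Tendsto N atTop atTop :=
    hNε.isBoltzmannGradSequence.tendsto_atTop hd one_ne_zero
  -- the limit: a measurable probability density at every time
  set f' : ℝ → UnitAddTorus d × EuclideanSpace ℝ d → ℝ := fun t z => f t z.1 z.2 with hf'def
  have hf'0 : ∀ t ∈ Icc 0 T, 0 ≤ f' t := fun t ht z => hmild.nonneg t ht z.1 z.2
  have hf'm : ∀ t ∈ Icc 0 T, Measurable (f' t) := fun t ht =>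
    ((hcont.1 t ht).1).measurable
  have hf'1 : ∀ t ∈ Icc 0 T, ∫ x, ∫ v, f' t (x, v) = 1 := by
    intro t ht
    obtain ⟨M, hM0, hM⟩ := exists_abs_le_of_continuousInLanfordOn hcont
    have hL : ∃ C : ℝ≥0∞, C < ∞ ∧ ∀ s ∈ Icc 0 T, eGaussSupNorm (β₀ / 2) (f s) ≤ C :=
      ⟨ENNReal.ofReal M, ENNReal.ofReal_lt_top, fun s hs => eGaussSupNorm_le_of_abs_le (hM s hs)⟩
    have hmass := Literature.Analysis.FluidPDE.IsMildBoltzmannSolutionOn.totalMass_eq_holds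
      (d := d) (T := T) (B := hardSphereKernel) hmild isGradCutoffKernel_hardSphereKernel
      (half_pos hβ₀) hL (fun s hs => (hcont.1 s hs).1) ht
    simp only [totalMass, hf0eq] at hmass
    change ∫ x, ∫ v, f t x v = 1
    rw [hmass, hf₀1]
  -- mode A ⇒ mode B along the shifted sequence `k ↦ k + k₀`
  have hshift : TendstoEmpirical (fun k => N (k + k₀))
      (fun k => particleLaw (Φ (k + k₀)) (W (k + k₀))) (fun k => (Φ (k + k₀)).flow) f' T := by
    refine tendstoEmpirical_of_ae_versions (X := UnitAddTorus d)
      (hNtop.comp (tendsto_add_atTop_nat k₀)) (fun k => Φ (k + k₀))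
      (fun k => isSymmetricFn_canonicalDensity F₀)
      (fun k => measurable_canonicalDensity' hF₀m) (fun k => canonicalDensity_nonneg' hF₀0)
      (fun k z hz => canonicalDensity_eq_zero_of_notMem' F₀ hz)
      (fun k => integral_canonicalDensity' F₀ (hk₀ (k + k₀) (Nat.le_add_left _ _)).ne')
      hf'0 hf'1 hf'm (F := fun k => F (k + k₀)) (fun k s t ht => hF (k + k₀) s t ht) ?_
    exact tendstoMarginals_shift hchaos k₀
  -- back to the original sequence
  intro t ht φ hφc hφs δ hδ
  have := hshift t ht φ hφc hφs δ hδ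
  exact (tendsto_add_atTop_iff_nat (f := fun k => particleLaw (Φ k) (W k)
    {z | δ < |∫ y, φ y ∂empiricalMeasure ((Φ k).flow t z) -
      ∫ x : UnitAddTorus d, ∫ v : EuclideanSpace ℝ d, φ (x, v) * f' t (x, v)|}) k₀).1 this

end LanfordEmpiricalAssembly

end

end Literature.MathematicalPhysics.KineticTheory
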